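import Literature.NumberTheory.ComplexMultiplication.CMTypeBasic
import Mathlib.NumberTheory.NumberField.InfinitePlace.Embeddings
import Mathlib.Algebra.Polynomial.BigOperators
import HarnessLib

/-!
# The rank-two Kottwitz signature census: E2's Lie-type product over the FLIPPED CONJUGATE CM type equals `∏_φ (X − φ b)^{m φ}`

Topic `NumberTheory/ComplexMultiplication`; namespace `Literature.NumberTheory.ComplexMultiplication.CMTypeOps`.
Theorems only (no definition, no named fact, no instance).  Cell `hodgecm-mathlib` (D-0151), FLOOR 0, P6 «MOD programme», door (E) of `stub_RGD`,
organ **E1∕E2 junction «census»** (A-p01 (g26), 2026-09-01): the E-LINE chart `AuxChartGS` of `Cruxes/HLiu418/Lines/F0_P6a_PELWitnessE.lean` types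
the Kottwitz clause of its `𝒪_F`-action as `Cb.charpoly = ∏ φ : F →+* ℂ, (X − φ b) ^ (mOf ι₁ Φ φ)` with the RANK-TWO signature
`mOf ι₁ Φ φ = 1` on the pair `{ι₁, ῑ₁}`, `0` on `Φ` off the pair, `2` off `Φ` and off the pair ([RapoportSmithlingZhang2020Diagonal] (3.14): `r_{φ₀} = 1`,
`r_φ = 0` on `Φ ∖ {φ₀}`, `r_φ̄ = n − r_φ`), whereas ★ E2 FILE D `exists_lieAction_charpoly` delivers, for its CM type `Ψ ∋ τ`, the census
`∏ ρ ∈ Ψ, (ρ = τ ? (X − ρ̄ b)(X − ρ b)^{n−1} : (X − ρ b)^n)`.  At `n = 2`, `τ = ι₁` the two agree EXACTLY for `Ψ := flip ι₁ (bar Φ) = {ι₁} ∪ conj(Φ ∖ {ι₁})`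
(★ `CMTypeOps.flip`, ★ `CMTypeOps.bar`) — the CM type GEN hands to E2.  `--supports stmt-HodgeConjecture-24832`, count-neutral; HC_CM is proved only modulo
the printed citations until rung 0 closes.

* `mem_flip_bar_iff` — `φ ∈ flip ι₁ (bar Φ) ↔ φ = ι₁ ∨ (φ ∉ Φ ∧ φ ≠ ῑ₁)` (`ι₁ ∈ Φ`); `mem_flip_bar_self`.
* `prod_embedding_eq_prod_cmType_mul` — `∏_{φ} f φ = ∏_{ρ ∈ Ψ} f ρ · f ρ̄` for any CM type `Ψ` (each embedding is exactly one of `ρ, ρ̄`).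
* HEAD `prod_lieCensus_flip_bar_eq_prod_pow` — the identity above, with the exponent function `m` axiomatised by its four values (GEN discharges them from
  `mOf` by `simp`).

## References
* [RapoportSmithlingZhang2020Diagonal] M. Rapoport, B. Smithling, W. Zhang (2020), §3.2 (3.8) p. 11, Remark 3.6 (3.14) p. 13.
* [Kottwitz1992] R. Kottwitz, JAMS 5 (1992), §5 p. 390 (determinant condition).
* [Shimura1998] G. Shimura, *Abelian varieties with complex multiplication and modular functions* (1998), §5.2 Thm. 1, §6.1 Thm. 2.
-/

set_option autoImplicit false

noncomputable section

open scoped Classical Polynomial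
open Polynomial NumberField NumberField.ComplexEmbedding

namespace Literature.NumberTheory.ComplexMultiplication

open Literature.AlgebraicGeometry.Motives (CMType)

namespace CMTypeOps

variable {K : Type*} [Field K]

/-! ### §1. The flipped conjugate type `{ι₁} ∪ conj(Φ ∖ {ι₁})` -/

/-- **Membership in `flip ι₁ (bar Φ)`** for `ι₁ ∈ Φ`: `φ = ι₁`, or `φ ∉ Φ` and `φ ≠ ῑ₁`. [cite: Shimura1998, §5.2 Thm. 1 (CM1)–(CM2), p. 40] -/
theorem mem_flip_bar_iff (Φ : CMType K) {ι₁ : K →+* ℂ} (hι : ι₁ ∈ Φ.1) (φ : K →+* ℂ) :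
    φ ∈ (flip ι₁ (bar Φ)).1 ↔ φ = ι₁ ∨ (φ ∉ Φ.1 ∧ φ ≠ conjugate ι₁) := by
  have hcι : conjugate ι₁ ∉ Φ.1 := (mem_iff_conjugate_notMem Φ ι₁).mp hι
  rw [mem_flip_iff]
  simp only [mem_bar_iff, placeSet, Set.mem_insert_iff, Set.mem_singleton_iff, not_or, not_not]
  constructor
  · rintro (⟨hφ, hne, hne'⟩ | ⟨h | h, hmem⟩)
    · exact Or.inr ⟨hφ, hne'⟩
    · exact Or.inl h
    · exact absurd hmem (h ▸ hcι)
  · rintro (h | ⟨hφ, hne'⟩)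
    · exact Or.inr ⟨Or.inl h, h ▸ hι⟩
    · refine Or.inl ⟨hφ, ?_, hne'⟩
      rintro rfl
      exact hφ hι

/-- `ι₁ ∈ flip ι₁ (bar Φ)` for `ι₁ ∈ Φ`. [cite: Shimura1998, §5.2 Thm. 1 (CM1)–(CM2), p. 40] -/
theorem mem_flip_bar_self (Φ : CMType K) {ι₁ : K →+* ℂ} (hι : ι₁ ∈ Φ.1) : ι₁ ∈ (flip ι₁ (bar Φ)).1 :=
  (mem_flip_bar_iff Φ hι ι₁).mpr (Or.inl rfl)

/-! ### §2. Products over all embeddings as products over a CM type of pairs -/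

/-- **`∏_φ f φ = ∏_{ρ ∈ Ψ} f ρ · f ρ̄`** for a CM type `Ψ`: every complex embedding is exactly one of `ρ`, `ρ̄` with `ρ ∈ Ψ`
(«the `2n` isomorphisms `φᵢ, φ̄ᵢ`»). [cite: Shimura1998, §6.1 Thm. 2, p. 41] -/
theorem prod_embedding_eq_prod_cmType_mul [NumberField K] {R : Type*} [CommMonoid R] (Ψ : CMType K) (f : (K →+* ℂ) → R) :
    ∏ φ : K →+* ℂ, f φ = ∏ ρ : Ψ.1, f ρ.1 * f (conjugate ρ.1) := by
  -- the pairing `Ψ ⊕ Ψ ≃ (K →+* ℂ)`, `inl ρ ↦ ρ`, `inr ρ ↦ ρ̄`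
  let g : Ψ.1 ⊕ Ψ.1 → (K →+* ℂ) := fun s => Sum.elim (fun ρ => ρ.1) (fun ρ => conjugate ρ.1) s
  have hinj : Function.Injective g := by
    rintro (ρ | ρ) (ρ' | ρ') h
    · exact congrArg Sum.inl (Subtype.ext h)
    · change ρ.1 = conjugate ρ'.1 at h
      exact absurd (h ▸ ρ.2 : conjugate ρ'.1 ∈ Ψ.1) ((mem_iff_conjugate_notMem Ψ ρ'.1).mp ρ'.2)
    · change conjugate ρ.1 = ρ'.1 at h
      exact absurd ρ'.2 (h ▸ (mem_iff_conjugate_notMem Ψ ρ.1).mp ρ.2)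
    · change conjugate ρ.1 = conjugate ρ'.1 at h
      exact congrArg Sum.inr (Subtype.ext ((involutive_conjugate K).injective h))
  have hsurj : Function.Surjective g := by
    intro φ
    rcases mem_or_conjugate_mem Ψ φ with h | h
    · exact ⟨Sum.inl ⟨φ, h⟩, rfl⟩
    · exact ⟨Sum.inr ⟨conjugate φ, h⟩, involutive_conjugate K φ⟩
  rw [← Fintype.prod_equiv (Equiv.ofBijective g ⟨hinj, hsurj⟩) (fun s => f (g s)) f (fun _ => rfl), Fintype.prod_sum_type,
    ← Finset.prod_mul_distrib]
  rfl

/-! ### §3. The census identity -/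

/-- **THE RANK-TWO CENSUS**: for `ι₁ ∈ Φ` and the exponent function of the E-line (`m ι₁ = m ῑ₁ = 1`, `m = 0` on `Φ` off the pair, `m = 2` off `Φ` and off
the pair), E2's Lie-type product over `Ψ = flip ι₁ (bar Φ)` at `n = 2`, `τ = ι₁` is `∏_φ (X − φ b)^{m φ}`.
[cite: RapoportSmithlingZhang2020Diagonal, §3.2 (3.8) p. 11 and Remark 3.6 (3.14) p. 13] [cite: Kottwitz1992, §5 p. 390] -/
theorem prod_lieCensus_flip_bar_eq_prod_pow [NumberField K] (Φ : CMType K) {ι₁ : K →+* ℂ} (hι : ι₁ ∈ Φ.1) (m : (K →+* ℂ) → ℕ)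
    (h1 : m ι₁ = 1) (h1' : m (conjugate ι₁) = 1) (h0 : ∀ φ ∈ Φ.1, φ ≠ ι₁ → φ ≠ conjugate ι₁ → m φ = 0)
    (h2 : ∀ φ ∉ Φ.1, φ ≠ ι₁ → φ ≠ conjugate ι₁ → m φ = 2) (b : K) :
    (∏ ρ : (flip ι₁ (bar Φ)).1,
        if ρ.1 = ι₁ then (X - C (conjugate ρ.1 b)) * (X - C (ρ.1 b)) ^ (2 - 1) else (X - C (ρ.1 b)) ^ 2) =
      ∏ φ : K →+* ℂ, (X - C (φ b)) ^ m φ := by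
  have hcι : conjugate ι₁ ∉ Φ.1 := (mem_iff_conjugate_notMem Φ ι₁).mp hι
  rw [prod_embedding_eq_prod_cmType_mul (flip ι₁ (bar Φ))]
  refine Finset.prod_congr rfl fun ρ _ => ?_
  by_cases hρ : ρ.1 = ι₁
  · rw [if_pos hρ, hρ, h1, h1', pow_one, pow_one, mul_comm]
  · obtain ⟨hρΦ, hρc⟩ := ((mem_flip_bar_iff Φ hι ρ.1).mp ρ.2).resolve_left hρ
    -- `ρ̄ ∈ Φ ∖ {ι₁, ῑ₁}`
    have hcρΦ : conjugate ρ.1 ∈ Φ.1 := (conjugate_mem_iff_notMem Φ ρ.1).mpr hρΦ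
    have hcρ1 : conjugate ρ.1 ≠ ι₁ := fun h => hρc ((congrArg conjugate h).symm.trans (involutive_conjugate K ρ.1)).symm
    have hcρ2 : conjugate ρ.1 ≠ conjugate ι₁ := fun h => hρ ((involutive_conjugate K).injective h)
    rw [if_neg hρ, h2 ρ.1 hρΦ hρ hρc, h0 (conjugate ρ.1) hcρΦ hcρ1 hcρ2, pow_zero, mul_one]

end CMTypeOps

end Literature.NumberTheory.ComplexMultiplication

end
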